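import Summits.BirchSwinnertonDyer.BirchSwinnertonDyer.Theorems.PrintCf2RubinValueTwoRowTwoSUnitRamified
import HarnessLib

/-!
# M-LINE-PIN / (α3) ROW 2, FILE 8d: twisting a tower of classes of roots of `p`-UNITS by `γ̃ − 1`, for a `γ̃ ∈ Γ_K` FIXING THE PLACES
# ABOVE `p`, gives classes of roots of GLOBAL UNITS (memo (C-c): `S_p`-units/units is killed by `ω_N(T_i) = γ_i^{p^N} − 1`)

Cell `bsd-print-cf2`, WIDTH seat `bsd-line-cf2-p1-w6` g10 (prover-bsd-line-cf2-p1-w6-g10-0), successor of g9 on (α3) ROW 2 of the JLK road on the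
DECIDING child stmt-BirchSwinnertonDyer-24721 `PrintCf2RubinValueTwo.MainConjClauseAtSplitTwoQuadDA` (memo `HOME/bsd-line-cf2-p1-w6/ROW2-RHO3-SPEC-w6g9.md`
§2 (C-c): third step of the COKERNEL half `hgcoker` of g8's FILE 4a); `--supports` that item (helper, Theses-free). HONEST FRAMING: valuations and the
twisted conjugation law; the displayed hypothesis is "`γ̃` fixes every place of `F` above `p`" (in the `ℤ_p²`-tower the places above `p` are finitely
many — g8's `TowerPlacesAboveTwo` — so some `γ_i^{p^N}` does); nothing here closes the crux or a registered stub; no summit statement is proved by this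
seat; BSD is not proved by any of this. THEOREMS ONLY (no definition, no named fact, no instance, no `sorry`).

WHAT. Setting of FILES 8b/8c (`U = Gal(K̄/F)`, `F ⊆ K_S` a number field Galois over `K`, `θ′|_U = 1`, `S ⊇ {v ∣ p}`). Let `y` be the twisted Kummer
class of an `N_S`-fixed `β` with `β^{p^k} = ε ∈ F` a `p`-UNIT (`ord_w ε = 0` for all `w ∤ p`; FILE 8c), and let `γ̃ ∈ Γ_K` with `θ′(γ̃) = 1` fix every
place of `F` above `p`. Then `γ̃·y − y` is the twisted Kummer class of `(γ̃β)β⁻¹`, whose `p^k`-th power `γ̃(ε)/ε` is a GLOBAL UNIT of `F`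
(`exists_globalUnit_isTwistedKummerClass_levelConj_sub`): `ord_w(γ̃ε) = ord_{γ̃⁻¹w}(ε)`, which is `ord_w(ε)` above `p` (`γ̃` fixes `w`) and `0` elsewhere.
§1: an element of `F` all of whose valuations are `1` is a global unit (`mem_globalUnitsOf_of_forall_valuation_eq_one`); §2: `γ̃(ε)/ε` has all
valuations `1` (`valuation_algEquiv_mul_inv_eq_one`); §3: the class computation (FILE 3h with `θ′(γ̃) = 1`, -w5 g10's inverse law).

presearch: «S-units modulo units, Galois action fixing the places, (σ−1) kills the valuation vector» — standard (Neukirch–Schmidt–Wingberg VIII §3,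
the map `E_S → ⊕_{v∈S} ℤ`; tree `SUnitsModUnitsValuations` p721971 of g8 gives the group form); the cohomological twist form here is bookkeeping
for ty2's pins. beyond-print theorem: no.

References: J. Neukirch, A. Schmidt, K. Wingberg (2008) VIII §3; J. Johnson-Leung, G. Kings (2011) §3.3 (5); J. W. S. Cassels, A. Fröhlich (1967)
Ch. VII §1; J. Neukirch, *Algebraic Number Theory* (1999) Ch. I (11.6).
-/

noncomputable section

open scoped Classical

-- the summit namespace `Summit.BirchSwinnertonDyer.BirchSwinnertonDyer` repeats the problem name by design (D-0017)
set_option linter.dupNamespace false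
set_option autoImplicit false

open scoped NumberField
open Field IsDedekindDomain IntermediateField WithZero
open Literature.NumberTheory.GaloisRepresentations Literature.NumberTheory.GaloisRepresentations.DiscreteGaloisModule
open Literature.NumberTheory.GaloisRepresentations.LocalWeilDatum
open Literature.NumberTheory.ComplexMultiplication.EllipticUnits
open Literature.NumberTheory.ComplexMultiplication.EllipticUnits.JohnsonLeungKings2011

namespace Summit.BirchSwinnertonDyer.BirchSwinnertonDyer.Theorems.PrintCf2.RowTwo

variable {K : Type} [Field K] [NumberField K] (p : ℕ) [Fact p.Prime] (S : Set (HeightOneSpectrum (𝓞 K)))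
  (θ : absoluteGaloisGroup K →ₜ* ℤ_[p]ˣ)

/-! ## §1. All valuations `1` ⟹ global unit -/

omit [NumberField K] in
/-- **An element of `F` with `ord_w = 0` at every finite place is a global unit**: it and its inverse lie in `𝓞 F` (Mathlib
`mem_integers_of_valuation_le_one`), hence are integral over `ℤ`; read in the tree's `ℰ(F) = globalUnitsOf F ⊆ K̄ˣ`. [cite: NeukirchANT1999, Ch. I (11.6)] -/
theorem mem_globalUnitsOf_of_forall_valuation_eq_one (F : IntermediateField K (AlgebraicClosure K)) [NumberField F] {x : F}
    (hx : ∀ w : HeightOneSpectrum (𝓞 F), w.valuation F x = 1) (u : (AlgebraicClosure K)ˣ)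
    (hu : (u : AlgebraicClosure K) = (x : AlgebraicClosure K)) : u ∈ globalUnitsOf F := by
  have hx0 : x ≠ 0 := by
    intro h0
    have h1 : (u : AlgebraicClosure K) = 0 := by rw [hu, h0, ZeroMemClass.coe_zero]
    exact u.ne_zero h1
  have hint : ∀ z : F, (∀ w : HeightOneSpectrum (𝓞 F), w.valuation F z = 1) → IsIntegral ℤ (z : AlgebraicClosure K) := by
    intro z hz
    obtain ⟨y, hy⟩ := IsDedekindDomain.HeightOneSpectrum.mem_integers_of_valuation_le_one (R := 𝓞 F) (K := ↥F) z (fun w ↦ (hz w).le)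
    have h1 : (z : AlgebraicClosure K) = algebraMap F (AlgebraicClosure K) (y : F) := by rw [← hy]; rfl
    rw [h1]
    exact (NumberField.RingOfIntegers.isIntegral_coe y).map (IsScalarTower.toAlgHom ℤ F (AlgebraicClosure K))
  refine ⟨by rw [hu]; exact hint x hx, ?_, by rw [hu]; exact x.2⟩
  have hinv : ((u⁻¹ : (AlgebraicClosure K)ˣ) : AlgebraicClosure K) = ((x⁻¹ : F) : AlgebraicClosure K) := by
    rw [Units.val_inv_eq_inv_val, hu]; push_cast; rfl
  rw [hinv]
  exact hint x⁻¹ fun w ↦ by rw [map_inv₀, hx w, inv_one]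

/-! ## §2. `γ̃(ε)/ε` has all valuations `1` when `ε` is a `p`-unit and `γ̃` fixes the places above `p` -/

omit [NumberField K] in
/-- **`ord_w(σ(ε)·ε⁻¹) = 0` at EVERY place** when `ord_w ε = 0` off a `σ`-STABLE set `T` of places each of which `σ` FIXES (`σ ∈ Gal(F/K)`):
above `T`, `ord_w σε = ord_{σ⁻¹w} ε = ord_w ε`; off `T`, `σ⁻¹ w ∉ T` too and both `ord_w σε`, `ord_w ε` vanish (`ord_{σw}(σx) = ord_w(x)`, Cassels–Fröhlich
VII §1). [cite: CasselsFrohlichANT1967, Ch. VII §1] -/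
theorem valuation_algEquiv_mul_inv_eq_one (F : IntermediateField K (AlgebraicClosure K)) [NumberField F]
    (T : Set (HeightOneSpectrum (𝓞 F))) (σ : F ≃ₐ[K] F) (hσT : ∀ w ∈ T, σ • w = w) (hT : ∀ w ∈ T, σ • w ∈ T)
    {ε : F} (hε0 : ε ≠ 0) (hε : ∀ w : HeightOneSpectrum (𝓞 F), w ∉ T → w.valuation F ε = 1) (w : HeightOneSpectrum (𝓞 F)) :
    w.valuation F (σ ε * ε⁻¹) = 1 := by
  have hvε0 : w.valuation F ε ≠ 0 := (Valuation.ne_zero_iff _).2 hε0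
  have key : w.valuation F (σ ε) = w.valuation F ε := by
    by_cases hw : w ∈ T
    · have h1 := Literature.NumberTheory.Automorphic.HeightOneSpectrum.valuation_algEquiv_smul K σ w ε
      rwa [hσT w hw] at h1
    · have h1 := Literature.NumberTheory.Automorphic.HeightOneSpectrum.valuation_algEquiv_smul K σ (σ⁻¹ • w) ε
      rw [smul_inv_smul] at h1
      have hw' : σ⁻¹ • w ∉ T := fun hmem ↦ hw (by have h2 := hT _ hmem; rwa [smul_inv_smul] at h2)
      rw [h1, hε _ hw', hε w hw]
  rw [map_mul, map_inv₀, key, mul_inv_cancel₀ hvε0]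

/-! ## §3. The twist by `γ̃ − 1` of a class of a root of a `p`-unit is the class of a root of a global unit -/

/-- **`γ̃·y − y` IS THE CLASS OF A ROOT OF A GLOBAL UNIT.** `U = Gal(K̄/F)` (`F ⊆ K̄` a number field Galois over `K`, `N_S ≤ U`, `θ′|_U = 1`,
`S ⊇ {v ∣ p}`); `y ∈ H¹(G_S(F), μ_{p^k} ⊗ θ′)` the twisted Kummer class of an `N_S`-fixed `β` with `β^{p^k} = ε ∈ F^×`, `ε` a `p`-UNIT (`w.valuation F ε = 1`
for all `w` not above `p`); `γ̃ ∈ Γ_K` with `θ′(γ̃) = 1` FIXING EVERY PLACE OF `F` ABOVE `p`. THEN `γ̃·y − y` (conjugation action) is the twisted Kummer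
class of the `N_S`-fixed `(γ̃β)·β⁻¹`, whose `p^k`-th power `γ̃(ε)·ε⁻¹` lies in `ℰ(F) = globalUnitsOf F`. (FILE 3h with `θ′(γ̃) = 1`: `γ̃·y = c′`, the class of
`γ̃β`; -w5 g10's inverse law; §2, §1.) [cite: JohnsonLeungKings2011, §3.3 (5) (arXiv p0010:L61–70)] [cite: NeukirchSchmidtWingberg2008, VIII §3] -/
theorem exists_globalUnit_isTwistedKummerClass_levelConj_sub [IsGalois K (AlgebraicClosure K)]
    (hSp : ∀ v : HeightOneSpectrum (𝓞 K), ((p : ℕ) : 𝓞 K) ∈ v.asIdeal → v ∈ S)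
    (F : IntermediateField K (AlgebraicClosure K)) [NumberField F] [Normal K F] [(galFixing K F).Normal]
    (hNF : ramificationSubgroup K S ≤ galFixing K F) (hθF : ∀ σ ∈ galFixing K F, θ σ = 1) {k : ℕ}
    {y : levelCoh p S θ (galFixing K F) k 1} {β : (AlgebraicClosure K)ˣ} {ε : F}
    (hβN : ∀ τ ∈ ramificationSubgroup K S, τ • β = β) (hβε : (β : AlgebraicClosure K) ^ p ^ k = (ε : AlgebraicClosure K))
    (hε : ∀ w : HeightOneSpectrum (𝓞 F), ((p : ℕ) : 𝓞 K) ∉ (w.under (𝓞 K)).asIdeal → w.valuation F ε = 1)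
    (hc : IsTwistedKummerClass p θ S (galFixing K F) k β y)
    {γt : absoluteGaloisGroup K} (hθγ : θ γt = 1)
    (hγfix : ∀ w : HeightOneSpectrum (𝓞 F), ((p : ℕ) : 𝓞 K) ∈ (w.under (𝓞 K)).asIdeal → resGal F γt • w = w) :
    (γt • β * β⁻¹) ^ p ^ k ∈ globalUnitsOf F ∧ (∀ τ ∈ ramificationSubgroup K S, τ • (γt • β * β⁻¹) = γt • β * β⁻¹) ∧
      IsTwistedKummerClass p θ S (galFixing K F) k (γt • β * β⁻¹) (levelConj p S θ (galFixing K F) k 1 γt y - y) := by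
  haveI : FiniteDimensional K F := Module.Finite.of_restrictScalars_finite ℚ K F
  have hε0 : ε ≠ 0 := by
    intro h0
    rw [h0, ZeroMemClass.coe_zero] at hβε
    exact (pow_ne_zero _ β.ne_zero) hβε
  -- `γ̃·y = c′`, the class of `γ̃β`
  obtain ⟨c', hc'⟩ := exists_isTwistedKummerClass_smul p S θ hSp F hNF hθF hβN hβε γt
  have hconj : levelConj p S θ (galFixing K F) k 1 γt y = c' := by
    rw [levelConj_eq_nsmul_of_isTwistedKummerClass p S θ (galFixing K F) k hc γt hc']
    have h1 : (((charModPow p θ k γt).val : ZMod (p ^ k)) * ((1 : ℕ) : ZMod (p ^ k))) = 1 := by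
      rw [Nat.cast_one, mul_one, ZMod.natCast_zmod_val, charModPow_apply, hθγ, Units.val_one, map_one]
    have h2 := mul_nsmul_levelCoh_eq_self p S θ k (galFixing K F) h1 c'
    rwa [mul_one] at h2
  refine ⟨?_, ?_, ?_⟩
  · -- the `p^k`-th power is `γ̃(ε)/ε`, a global unit
    have hpow : (((γt • β * β⁻¹) ^ p ^ k : (AlgebraicClosure K)ˣ) : AlgebraicClosure K) =
        ((resGal F γt ε * ε⁻¹ : F) : AlgebraicClosure K) := by
      rw [mul_pow, inv_pow, ← smul_pow', Units.val_mul, Units.val_inv_eq_inv_val, Units.coe_smul, Units.val_pow_eq_pow_val, hβε]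
      push_cast
      rw [coe_resGal_apply]
    refine mem_globalUnitsOf_of_forall_valuation_eq_one F ?_ _ hpow
    exact valuation_algEquiv_mul_inv_eq_one F {w | ((p : ℕ) : 𝓞 K) ∈ (w.under (𝓞 K)).asIdeal} (resGal F γt) hγfix
      (fun w hw ↦ by
        change ((p : ℕ) : 𝓞 K) ∈ ((resGal F γt • w).under (𝓞 K)).asIdeal
        rw [Literature.NumberTheory.Automorphic.HeightOneSpectrum.under_algEquiv_smul K F (resGal F γt) w]
        exact hw)
      hε0 (fun w hw ↦ hε w hw)
  · intro τ hτ
    rw [smul_mul', TwistedZeta.smul_smul_eq_of_mem_normal (ramificationSubgroup K S) hβN γt τ hτ, smul_inv', hβN τ hτ]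
  · have h1 := TwistedZeta.isTwistedKummerClass_pow_mul_inv p S θ k (galFixing K F) hc' hc 1
    rwa [pow_one, Nat.cast_one, one_zsmul, ← hconj] at h1

end Summit.BirchSwinnertonDyer.BirchSwinnertonDyer.Theorems.PrintCf2.RowTwo

end
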